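import Mathlib
import HarnessLib
import Summits.HubbardSuperconductivity.HubbardSuperconductivity.Theorems.KLProgrammeC4aLevelChartInj
import Summits.HubbardSuperconductivity.HubbardSuperconductivity.Theorems.KLProgrammeKLRegimeCountertermFrameCurveLipschitz

/-!
# Route `KLProgramme` — crux C4a: the JACOBIAN of the co-moving chart and the momentum ↔ chart CHANGE OF VARIABLES on the tube
# ((L2): the bridge from a momentum-space one-slice integral to the chart-coordinate tadpole of `…C4aTadpoleJets`)

Cell `gate-hubbard-kl`, lane hubbard-kl-c4a-1 (g2); helper for the engine-flow child `KLRegimeEngineV17F2` (stmt-HubbardSuperconductivity-20437),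
stub (C) `stub_twoLeg_curvature` (memo HOME/hubbard-kl-c4a-1/C4A-PLAN.md §9 (L2): «the 2-D change of variables on the tube»).

The chart of `…C4aInvariantDefs` is `levelPoint μ K ρ ϑ = u_K(μ+ρ; ϑ)·(cos ϑ, sin ϑ)` with `u_K(·; ϑ) = perturbedFermiRadius δ_K · ϑ` the
canonical radius (`e_K(levelPoint μ K ρ ϑ) = ρ`).  Written in the plane `ℝ × ℝ` it FACTORS THROUGH MATHLIB'S POLAR COORDINATES:
  `levelChart μ K (ρ, ϑ) = polarCoord.symm (u_K(μ+ρ; ϑ), ϑ)`,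
so its derivative is `D(polarCoord.symm)(u, ϑ) ∘ D(ρ,ϑ ↦ (u, ϑ))` and its Jacobian determinant is `u · ∂_ρ u` (the polar factor `u` =
`det_fderivPolarCoordSymm`, times the radial factor `∂_ρ u = ∂_μ u ∈ (0, 1/(Dt_min − 2A)]` of `…C4aLevelChart`) — positive, bounded by
`π√2/(Dt_min − 2A)`, with NO matrix computation beyond an upper-triangular `2 × 2`.

* §1 `levelChart`, `levelChart_apply` (`= (u cos ϑ, u sin ϑ)`), its components are those of `levelPoint` (`levelChart_fst/snd`);
* §2 `hasFDerivAt_levelChart` (chain rule through `hasFDerivAt_polarCoord_symm`), `det_levelChartDeriv` (`= u · ∂_ρu`, the radial partial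
  read as `fderiv (ρ,ϑ ↦ u) p (1, 0) = ∂_μ u_K(μ + ρ; ϑ)`), `levelChartJac_pos`, `levelChartJac_le`;
* §3 `levelChart_injOn` on `(−r, r) × (−π, π]` (from `levelPoint_injOn`);
* §4 **`integral_image_levelChart`**: for ANY `g : ℝ × ℝ → E`,
  `∫ q in levelChart μ K '' ((−r,r) ×ˢ (−π,π]), g q = ∫ p in (−r,r) ×ˢ (−π,π], (u·∂_ρu)(p) • g (levelChart μ K p)`
  (Mathlib's `integral_image_eq_integral_abs_det_fderiv_smul`; the absolute value is removed by positivity).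

The identification of the image with the momentum tube `{|e_K| < r}` inside the open square (surjectivity, by ray-wise uniqueness of the
radius) and the `(−π, π] → (0, 2π]` shift to the angular window of `…C4aTadpoleJets` are the next file's business.
Pure calculus on the tree's objects; nothing is asserted about the Hubbard model.  References: BGM 2006 §2.4 Lemma 2.1 (2.40)
[cite: BenfattoGiulianiMastropietro2006]; FST II CPAM 51 (1998) 1133 (H2)(2).
-/

noncomputable section

namespace Summit.HubbardSuperconductivity.HubbardSuperconductivity.Theorems.C4a

set_option linter.dupNamespace false -- summit = problem name (single-conjunct summit), D-0017

open Real Set MeasureTheory Filter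
open scoped Topology
open Literature.MathematicalPhysics.QuantumLattice Literature.MathematicalPhysics.QuantumLattice.BandSectorCounting
open Summit.HubbardSuperconductivity.HubbardSuperconductivity.Theorems.DispersionFlow
open Summit.HubbardSuperconductivity.HubbardSuperconductivity.Theorems.KLRegimeSplit
open Summit.HubbardSuperconductivity.HubbardSuperconductivity.Theorems.PerturbedFermiCurve

/-! ## §1 The chart in the plane, through polar coordinates -/

/-- **The co-moving chart in the plane**: `levelChart μ K (ρ, ϑ) = polarCoord.symm (u_K(μ+ρ; ϑ), ϑ) = (u cos ϑ, u sin ϑ)`,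
`u = perturbedFermiRadius δ_K (μ + ρ) ϑ` — the `ℝ × ℝ` coordinates of `levelPoint μ K ρ ϑ`. -/
def levelChart (μ : ℝ) (K : TrigPolyC4v) (p : ℝ × ℝ) : ℝ × ℝ :=
  polarCoord.symm (perturbedFermiRadius (fun k : Fin 2 → ℝ => -K.eval k) (μ + p.1) p.2, p.2)

/-- `levelChart μ K (ρ, ϑ) = (u cos ϑ, u sin ϑ)`. -/
theorem levelChart_apply (μ : ℝ) (K : TrigPolyC4v) (p : ℝ × ℝ) :
    levelChart μ K p = (perturbedFermiRadius (fun k : Fin 2 → ℝ => -K.eval k) (μ + p.1) p.2 * Real.cos p.2,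
      perturbedFermiRadius (fun k : Fin 2 → ℝ => -K.eval k) (μ + p.1) p.2 * Real.sin p.2) := by
  simp [levelChart, polarCoord_symm_apply]

/-- The first plane coordinate is the first component of `levelPoint`. -/
theorem levelChart_fst (μ : ℝ) (K : TrigPolyC4v) (p : ℝ × ℝ) : (levelChart μ K p).1 = levelPoint μ K p.1 p.2 0 := by
  rw [levelChart_apply, levelPoint_apply_zero]

/-- The second plane coordinate is the second component of `levelPoint`. -/
theorem levelChart_snd (μ : ℝ) (K : TrigPolyC4v) (p : ℝ × ℝ) : (levelChart μ K p).2 = levelPoint μ K p.1 p.2 1 := by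
  rw [levelChart_apply, levelPoint_apply_one]

/-- `levelChart` is `polarCoord.symm` after the radial reparametrisation `(ρ, ϑ) ↦ (u_K(μ+ρ; ϑ), ϑ)`. -/
theorem levelChart_eq_comp (μ : ℝ) (K : TrigPolyC4v) :
    levelChart μ K = polarCoord.symm ∘ fun p : ℝ × ℝ =>
      (perturbedFermiRadius (fun k : Fin 2 → ℝ => -K.eval k) (μ + p.1) p.2, p.2) := rfl

/-! ## §2 Derivative and Jacobian determinant -/

/-- An `ℝ`-linear functional on the plane, paired with the second coordinate, is the upper-triangular matrix
`!![φ(1,0), φ(0,1); 0, 1]` in the standard basis. -/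
theorem prod_snd_eq_toLin (φ : ℝ × ℝ →L[ℝ] ℝ) :
    φ.prod (ContinuousLinearMap.snd ℝ ℝ ℝ) =
      LinearMap.toContinuousLinearMap
        (Matrix.toLin (Module.Basis.finTwoProd ℝ) (Module.Basis.finTwoProd ℝ) !![φ (1, 0), φ (0, 1); 0, 1]) := by
  rw [Matrix.toLin_finTwoProd_toContinuousLinearMap]
  refine ContinuousLinearMap.ext fun q => ?_
  obtain ⟨x, y⟩ := q
  have hlin : φ (x, y) = x * φ (1, 0) + y * φ (0, 1) := by
    have : ((x, y) : ℝ × ℝ) = x • ((1 : ℝ), (0 : ℝ)) + y • ((0 : ℝ), (1 : ℝ)) := by ext <;> simp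
    rw [this, map_add, map_smul, map_smul, smul_eq_mul, smul_eq_mul]
  refine Prod.ext ?_ ?_
  · simp [hlin, mul_comm]
  · simp

/-- Its determinant is the `(1,0)`-entry `φ(1,0)`. -/
theorem det_prod_snd (φ : ℝ × ℝ →L[ℝ] ℝ) : (φ.prod (ContinuousLinearMap.snd ℝ ℝ ℝ)).det = φ (1, 0) := by
  rw [prod_snd_eq_toLin]
  simp only [ContinuousLinearMap.det, LinearMap.det_toContinuousLinearMap, LinearMap.det_toLin, Matrix.det_fin_two_of]
  ring

section Deriv

variable {a b : ℝ} (B : BandBounds a b) {K : TrigPolyC4v} {A : ℝ}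
  (hA : ∀ p : Momentum, ∀ j ≤ 2, ‖iteratedFDeriv ℝ j (frameShift K) p‖ ≤ A) (hADt : 2 * A < B.Dtmin)
  {μ : ℝ} {p : ℝ × ℝ} (hlo : a < μ + p.1 - A) (hhi : μ + p.1 + A < b)
include B hA hADt hlo hhi

/-- The radial function `(ρ, ϑ) ↦ u_K(μ+ρ; ϑ)` is Fréchet differentiable at `p` (it is jointly `C^∞`, `contDiffAt_levelRadius`). -/
theorem hasFDerivAt_levelRadius :
    HasFDerivAt (fun q : ℝ × ℝ => perturbedFermiRadius (fun k : Fin 2 → ℝ => -K.eval k) (μ + q.1) q.2)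
      (fderiv ℝ (fun q : ℝ × ℝ => perturbedFermiRadius (fun k : Fin 2 → ℝ => -K.eval k) (μ + q.1) q.2) p) p := by
  have h := contDiffAt_levelRadius B hA hADt (μ := μ) (ρ₀ := p.1) hlo hhi (m := 1) p.2
  exact (h.differentiableAt (by norm_num)).hasFDerivAt

/-- **Derivative of the chart** (chain rule through polar coordinates):
`D(levelChart μ K)(p) = fderivPolarCoordSymm (u, ϑ) ∘ (Du(p), dϑ)`. -/
theorem hasFDerivAt_levelChart :
    HasFDerivAt (levelChart μ K)
      ((fderivPolarCoordSymm (perturbedFermiRadius (fun k : Fin 2 → ℝ => -K.eval k) (μ + p.1) p.2, p.2)).comp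
        ((fderiv ℝ (fun q : ℝ × ℝ => perturbedFermiRadius (fun k : Fin 2 → ℝ => -K.eval k) (μ + q.1) q.2) p).prod
          (ContinuousLinearMap.snd ℝ ℝ ℝ))) p := by
  have h1 := (hasFDerivAt_levelRadius B hA hADt hlo hhi).prodMk (hasFDerivAt_snd (𝕜 := ℝ) (E := ℝ) (F := ℝ) (p := p))
  have h2 := hasFDerivAt_polarCoord_symm (perturbedFermiRadius (fun k : Fin 2 → ℝ => -K.eval k) (μ + p.1) p.2, p.2)
  rw [levelChart_eq_comp]
  exact h2.comp p h1

/-- **The radial partial**: `Du(p)(1, 0) = ∂_μ u_K(μ + ρ; ϑ)` (the level derivative of `…C4aLevelChart`). -/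
theorem fderiv_levelRadius_apply_one_zero :
    fderiv ℝ (fun q : ℝ × ℝ => perturbedFermiRadius (fun k : Fin 2 → ℝ => -K.eval k) (μ + q.1) q.2) p (1, 0) =
      deriv (fun m : ℝ => perturbedFermiRadius (fun k : Fin 2 → ℝ => -K.eval k) m p.2) (μ + p.1) := by
  have hF := hasFDerivAt_levelRadius B hA hADt hlo hhi
  have hF' : HasFDerivAt (fun q : ℝ × ℝ => perturbedFermiRadius (fun k : Fin 2 → ℝ => -K.eval k) (μ + q.1) q.2)
      (fderiv ℝ (fun q : ℝ × ℝ => perturbedFermiRadius (fun k : Fin 2 → ℝ => -K.eval k) (μ + q.1) q.2) p)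
      ((fun ρ : ℝ => ((ρ, p.2) : ℝ × ℝ)) p.1) := by
    simp only [Prod.mk.eta]; exact hF
  -- the line ρ ↦ (ρ, ϑ) through p
  have hline : HasDerivAt (fun ρ : ℝ => ((ρ, p.2) : ℝ × ℝ)) ((1 : ℝ), (0 : ℝ)) p.1 :=
    (hasDerivAt_id p.1).prodMk (hasDerivAt_const p.1 p.2)
  have hcomp : HasDerivAt
      ((fun q : ℝ × ℝ => perturbedFermiRadius (fun k : Fin 2 → ℝ => -K.eval k) (μ + q.1) q.2) ∘ fun ρ : ℝ => ((ρ, p.2) : ℝ × ℝ))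
      (fderiv ℝ (fun q : ℝ × ℝ => perturbedFermiRadius (fun k : Fin 2 → ℝ => -K.eval k) (μ + q.1) q.2) p ((1 : ℝ), (0 : ℝ)))
      p.1 :=
    hF'.comp_hasDerivAt p.1 hline
  -- the same line read through the level: ρ ↦ u(μ + ρ; ϑ)
  have hshift : HasDerivAt
      ((fun q : ℝ × ℝ => perturbedFermiRadius (fun k : Fin 2 → ℝ => -K.eval k) (μ + q.1) q.2) ∘ fun ρ : ℝ => ((ρ, p.2) : ℝ × ℝ))
      (deriv (fun m : ℝ => perturbedFermiRadius (fun k : Fin 2 → ℝ => -K.eval k) m p.2) (μ + p.1)) p.1 := by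
    have hC : ContDiff ℝ ((⊤ : ℕ∞) : WithTop ℕ∞) (fun k : Fin 2 → ℝ => -K.eval k) := by
      rw [← frameShift_toLp_eq_neg_eval]; exact contDiff_frameShift_toLp K
    have hδ : ∀ k : Fin 2 → ℝ, (∀ i, |k i| ≤ π) → |(fun q : Fin 2 → ℝ => -K.eval q) k| ≤ A := fun k _ => by
      simpa [frameShift_toLp] using abs_frameShift_toLp_le hA k
    have hκ : ∀ k : Fin 2 → ℝ, (∀ i, |k i| ≤ π) → ‖fderiv ℝ (fun q : Fin 2 → ℝ => -K.eval q) k‖ ≤ 2 * A := fun k _ => by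
      rw [← frameShift_toLp_eq_neg_eval]; exact norm_fderiv_frameShift_toLp_le hA k
    have hlev := hasDerivAt_perturbedFermiRadius_level B hC (by simp) hδ hκ hADt (μ₀ := μ + p.1) hlo hhi p.2
    have h2 : HasDerivAt (fun m : ℝ => perturbedFermiRadius (fun k : Fin 2 → ℝ => -K.eval k) m p.2)
        (deriv (fun m : ℝ => perturbedFermiRadius (fun k : Fin 2 → ℝ => -K.eval k) m p.2) (μ + p.1)) (μ + p.1) := by
      rw [hlev.deriv]; exact hlev
    have h3 := h2.comp p.1 ((hasDerivAt_id p.1).const_add μ)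
    have h4 : HasDerivAt (fun ρ : ℝ => perturbedFermiRadius (fun k : Fin 2 → ℝ => -K.eval k) (μ + ρ) p.2)
        (deriv (fun m : ℝ => perturbedFermiRadius (fun k : Fin 2 → ℝ => -K.eval k) m p.2) (μ + p.1)) p.1 := by
      simpa [Function.comp_def] using h3
    exact h4
  exact hcomp.unique hshift

/-- **The Jacobian determinant of the chart is `u · ∂_ρu`.** -/
theorem det_levelChartDeriv :
    ((fderivPolarCoordSymm (perturbedFermiRadius (fun k : Fin 2 → ℝ => -K.eval k) (μ + p.1) p.2, p.2)).comp
        ((fderiv ℝ (fun q : ℝ × ℝ => perturbedFermiRadius (fun k : Fin 2 → ℝ => -K.eval k) (μ + q.1) q.2) p).prod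
          (ContinuousLinearMap.snd ℝ ℝ ℝ))).det =
      perturbedFermiRadius (fun k : Fin 2 → ℝ => -K.eval k) (μ + p.1) p.2 *
        deriv (fun m : ℝ => perturbedFermiRadius (fun k : Fin 2 → ℝ => -K.eval k) m p.2) (μ + p.1) := by
  set Apol := fderivPolarCoordSymm (perturbedFermiRadius (fun k : Fin 2 → ℝ => -K.eval k) (μ + p.1) p.2, p.2) with hApol
  set Brad := (fderiv ℝ (fun q : ℝ × ℝ => perturbedFermiRadius (fun k : Fin 2 → ℝ => -K.eval k) (μ + q.1) q.2) p).prod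
    (ContinuousLinearMap.snd ℝ ℝ ℝ) with hBrad
  have h1 : Apol.det = perturbedFermiRadius (fun k : Fin 2 → ℝ => -K.eval k) (μ + p.1) p.2 := by
    rw [hApol, det_fderivPolarCoordSymm]
  have h2 : Brad.det = deriv (fun m : ℝ => perturbedFermiRadius (fun k : Fin 2 → ℝ => -K.eval k) m p.2) (μ + p.1) := by
    rw [hBrad, det_prod_snd, fderiv_levelRadius_apply_one_zero B hA hADt hlo hhi]
  rw [show (Apol.comp Brad).det = Apol.det * Brad.det from LinearMap.det_comp _ _, h1, h2]

/-- **The Jacobian is positive**: `0 < u · ∂_ρu`. -/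
theorem levelChartJac_pos :
    0 < perturbedFermiRadius (fun k : Fin 2 → ℝ => -K.eval k) (μ + p.1) p.2 *
        deriv (fun m : ℝ => perturbedFermiRadius (fun k : Fin 2 → ℝ => -K.eval k) m p.2) (μ + p.1) := by
  have hC : ContDiff ℝ ((⊤ : ℕ∞) : WithTop ℕ∞) (fun k : Fin 2 → ℝ => -K.eval k) := by
    rw [← frameShift_toLp_eq_neg_eval]; exact contDiff_frameShift_toLp K
  have hδ : ∀ k : Fin 2 → ℝ, (∀ i, |k i| ≤ π) → |(fun q : Fin 2 → ℝ => -K.eval q) k| ≤ A := fun k _ => by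
    simpa [frameShift_toLp] using abs_frameShift_toLp_le hA k
  have hκ : ∀ k : Fin 2 → ℝ, (∀ i, |k i| ≤ π) → ‖fderiv ℝ (fun q : Fin 2 → ℝ => -K.eval q) k‖ ≤ 2 * A := fun k _ => by
    rw [← frameShift_toLp_eq_neg_eval]; exact norm_fderiv_frameShift_toLp_le hA k
  have hd := (deriv_perturbedFermiRadius_level_pos_le B hC (by simp) hδ hκ hADt (μ₀ := μ + p.1) hlo hhi p.2).1
  have hu : 0 < perturbedFermiRadius (fun k : Fin 2 → ℝ => -K.eval k) (μ + p.1) p.2 :=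
    levelRadius_pos B hA hlo.le hhi.le p.2
  exact mul_pos hu hd

/-- **The Jacobian is bounded**: `u · ∂_ρu ≤ π√2 / (Dt_min − 2A)`. -/
theorem levelChartJac_le :
    perturbedFermiRadius (fun k : Fin 2 → ℝ => -K.eval k) (μ + p.1) p.2 *
        deriv (fun m : ℝ => perturbedFermiRadius (fun k : Fin 2 → ℝ => -K.eval k) m p.2) (μ + p.1) ≤
      π * Real.sqrt 2 / (B.Dtmin - 2 * A) := by
  have hC : ContDiff ℝ ((⊤ : ℕ∞) : WithTop ℕ∞) (fun k : Fin 2 → ℝ => -K.eval k) := by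
    rw [← frameShift_toLp_eq_neg_eval]; exact contDiff_frameShift_toLp K
  have hδ : ∀ k : Fin 2 → ℝ, (∀ i, |k i| ≤ π) → |(fun q : Fin 2 → ℝ => -K.eval q) k| ≤ A := fun k _ => by
    simpa [frameShift_toLp] using abs_frameShift_toLp_le hA k
  have hκ : ∀ k : Fin 2 → ℝ, (∀ i, |k i| ≤ π) → ‖fderiv ℝ (fun q : Fin 2 → ℝ => -K.eval q) k‖ ≤ 2 * A := fun k _ => by
    rw [← frameShift_toLp_eq_neg_eval]; exact norm_fderiv_frameShift_toLp_le hA k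
  have hd := deriv_perturbedFermiRadius_level_pos_le B hC (by simp) hδ hκ hADt (μ₀ := μ + p.1) hlo hhi p.2
  have hu : 0 < perturbedFermiRadius (fun k : Fin 2 → ℝ => -K.eval k) (μ + p.1) p.2 :=
    levelRadius_pos B hA hlo.le hhi.le p.2
  have hule : perturbedFermiRadius (fun k : Fin 2 → ℝ => -K.eval k) (μ + p.1) p.2 ≤ π * Real.sqrt 2 :=
    frameRadius_le B hA hlo.le hhi.le p.2
  have hden : 0 < B.Dtmin - 2 * A := by linarith
  rw [le_div_iff₀ hden]
  calc perturbedFermiRadius (fun k : Fin 2 → ℝ => -K.eval k) (μ + p.1) p.2 *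
        deriv (fun m : ℝ => perturbedFermiRadius (fun k : Fin 2 → ℝ => -K.eval k) m p.2) (μ + p.1) * (B.Dtmin - 2 * A)
      ≤ perturbedFermiRadius (fun k : Fin 2 → ℝ => -K.eval k) (μ + p.1) p.2 * ((B.Dtmin - 2 * A)⁻¹ * (B.Dtmin - 2 * A)) := by
        rw [mul_assoc]
        exact mul_le_mul_of_nonneg_left (mul_le_mul_of_nonneg_right hd.2 hden.le) hu.le
    _ = perturbedFermiRadius (fun k : Fin 2 → ℝ => -K.eval k) (μ + p.1) p.2 := by
        rw [inv_mul_cancel₀ hden.ne', mul_one]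
    _ ≤ π * Real.sqrt 2 := hule

end Deriv

/-! ## §3 Injectivity on the tube -/

section Inj

variable {a b : ℝ} (B : BandBounds a b) {K : TrigPolyC4v} {A : ℝ}
  (hA : ∀ p : Momentum, ∀ j ≤ 2, ‖iteratedFDeriv ℝ j (frameShift K) p‖ ≤ A)
  {μ r : ℝ} (hlo : a ≤ μ - r - A) (hhi : μ + r + A ≤ b)
include B hA hlo hhi

/-- **The plane chart is injective on `(−r, r) × (−π, π]`** (from `levelPoint_injOn`: the frame band reads the level, the direction
of a vector of positive length reads the angle). -/
theorem levelChart_injOn : InjOn (levelChart μ K) (Ioo (-r) r ×ˢ Ioc (-π) π) := by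
  intro p hp q hq h
  have hp1 : p.1 ∈ Ioo (-r) r := (mem_prod.1 hp).1
  have hq1 : q.1 ∈ Ioo (-r) r := (mem_prod.1 hq).1
  have hP : levelPoint μ K p.1 p.2 = levelPoint μ K q.1 q.2 := by
    ext i
    fin_cases i
    · show levelPoint μ K p.1 p.2 0 = levelPoint μ K q.1 q.2 0
      rw [← levelChart_fst, ← levelChart_fst, h]
    · show levelPoint μ K p.1 p.2 1 = levelPoint μ K q.1 q.2 1
      rw [← levelChart_snd, ← levelChart_snd, h]
  obtain ⟨h1, h2⟩ := levelPoint_injOn B hA (μ := μ) (by linarith [hp1.1]) (by linarith [hp1.2]) (by linarith [hq1.1])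
    (by linarith [hq1.2]) (mem_prod.1 hp).2 (mem_prod.1 hq).2 hP
  exact Prod.ext h1 h2

end Inj

/-! ## §4 The change of variables: momentum plane ↔ chart coordinates on the tube -/

section CoV

variable {a b : ℝ} (B : BandBounds a b) {K : TrigPolyC4v} {A : ℝ}
  (hA : ∀ p : Momentum, ∀ j ≤ 2, ‖iteratedFDeriv ℝ j (frameShift K) p‖ ≤ A) (hADt : 2 * A < B.Dtmin)
  {μ r : ℝ} (hlo : a < μ - r - A) (hhi : μ + r + A < b)
include B hA hADt hlo hhi

/-- **Change of variables on the tube.**  For every `g : ℝ × ℝ → E`: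
`∫ q in levelChart μ K '' ((−r,r) ×ˢ (−π,π]), g q = ∫ p in (−r,r) ×ˢ (−π,π], (u·∂_ρu)(p) • g (levelChart μ K p)` — the momentum-plane
integral over the image of the chart box is the chart-coordinate integral against the positive Jacobian `u·∂_ρu`
(`integral_image_eq_integral_abs_det_fderiv_smul` with `hasFDerivAt_levelChart`, `det_levelChartDeriv`, `levelChart_injOn`). -/
theorem integral_image_levelChart {E : Type*} [NormedAddCommGroup E] [NormedSpace ℝ E] (g : ℝ × ℝ → E) :
    ∫ q in levelChart μ K '' (Ioo (-r) r ×ˢ Ioc (-π) π), g q =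
      ∫ p in Ioo (-r) r ×ˢ Ioc (-π) π,
        (perturbedFermiRadius (fun k : Fin 2 → ℝ => -K.eval k) (μ + p.1) p.2 *
          deriv (fun m : ℝ => perturbedFermiRadius (fun k : Fin 2 → ℝ => -K.eval k) m p.2) (μ + p.1)) • g (levelChart μ K p) := by
  set S : Set (ℝ × ℝ) := Ioo (-r) r ×ˢ Ioc (-π) π with hS
  have hSm : MeasurableSet S := measurableSet_Ioo.prod measurableSet_Ioc
  have hlo' : ∀ p ∈ S, a < μ + p.1 - A := fun p hp => by
    have := (mem_prod.1 hp).1.1; linarith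
  have hhi' : ∀ p ∈ S, μ + p.1 + A < b := fun p hp => by
    have := (mem_prod.1 hp).1.2; linarith
  have hderiv : ∀ p ∈ S, HasFDerivWithinAt (levelChart μ K)
      ((fderivPolarCoordSymm (perturbedFermiRadius (fun k : Fin 2 → ℝ => -K.eval k) (μ + p.1) p.2, p.2)).comp
        ((fderiv ℝ (fun q : ℝ × ℝ => perturbedFermiRadius (fun k : Fin 2 → ℝ => -K.eval k) (μ + q.1) q.2) p).prod
          (ContinuousLinearMap.snd ℝ ℝ ℝ))) S p := fun p hp =>
    (hasFDerivAt_levelChart B hA hADt (hlo' p hp) (hhi' p hp)).hasFDerivWithinAt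
  have hinj : InjOn (levelChart μ K) S := levelChart_injOn B hA (μ := μ) (r := r) (by linarith) (by linarith)
  rw [integral_image_eq_integral_abs_det_fderiv_smul volume hSm hderiv hinj g]
  refine setIntegral_congr_fun hSm fun p hp => ?_
  rw [det_levelChartDeriv B hA hADt (hlo' p hp) (hhi' p hp), abs_of_pos (levelChartJac_pos B hA hADt (hlo' p hp) (hhi' p hp))]

end CoV

end Summit.HubbardSuperconductivity.HubbardSuperconductivity.Theorems.C4a
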